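import Summits.Schanuel.Schanuel.Theorems.ZilberEacParamCurveRayRootsSub
import Summits.Schanuel.Schanuel.Theorems.ZilberEacParamSurfaceEscapeRoots
import Summits.Schanuel.Schanuel.Theorems.ZilberEacParamFibreCurveSubleading
import Summits.Schanuel.Schanuel.Theorems.ZilberEacParamSurfaceUnbalanced
import Summits.Schanuel.Schanuel.Theorems.ZilberEacParamSurfaceDensity
import HarnessLib

/-!
# Polynomially parametrised base curves, XXXV: NON-SPLIT surfaces over a CURVED REAL LINE
# (`deg g₀ = deg g₁`, real irrational leading ratio, non-proportional sub-leading coefficients)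

HONEST FRAMING.  Cell `pub-schanuel` (Zilber's Exponential-Algebraic Closedness, case ladder;
host summit Schanuel), seat 2, gen 20.  Let `deg g₀ = deg g₁ = n ≥ 2` with REAL leading ratio
`λ = lc(g₁)/lc(g₀)`.  Along the roots of the balance `R_s = g₁ + s g₀` (`s ∈ ℚ` the slope of the
lower-left edge of the `y`-support of `Q`) the LEADING real parts of both coordinates vanish
(`lc(g₀) ω^n = 2πiσ/(λ + s) ∈ iℝ`) — this is why straight real lines needed the technology of gens
10–18.  On a CURVED real line, `lc(g₀)(g₁)_{n-1} ≠ lc(g₁)(g₀)_{n-1}`, the sub-leading order takes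
over: `Re g₀(t_k) ≍ c ρ^{n-1}` along the located zeros (files XXVIII/XXXIV), so the off-edge part
decays on the small discs and the engine of file XXXIII applies; THEOREM G in `x₀` at the
sub-leading order (file XXX).  THEOREM (`unprojectedDense_paramSurface₃_of_curvedReal`):
`deg g₀ = deg g₁ = n ≥ 2`, `Im(lc(g₁)/lc(g₀)) = 0`, `Re(lc(g₁)/lc(g₀))` irrational,
`lc(g₀)(g₁)_{n-1} ≠ lc(g₁)(g₀)_{n-1}`, `Q ∈ ℂ[t, y₀, y₁]` irreducible with two monomials of
different `y₁`-degree ⟹ the exponential points of `S(g; Q)` are Zariski dense.  (The irrationality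
only serves `λ + s ≠ 0` for every edge slope `s ∈ ℚ`; rational `λ ≠ -s(Q)` works the same way but
is not stated.)  Mantova–Masser's question is OPEN in general (PLMS 2024 §1 p. 5); NOT Schanuel's
conjecture (neither used nor implied; EAC ⇏ SC); `EC(3,2)` stays OPEN.
-/

noncomputable section

open Filter Topology Metric Set Complex MvPolynomial
open Literature.NumberTheory.Transcendental Literature.ModelTheory.Zilber
open Literature.ModelTheory.ExponentialFields

set_option linter.dupNamespace false

namespace Summit.Schanuel.Schanuel.Theorems

/-! ## Part A. The balance polynomial `R_s = g₁ + s g₀` on a curved real line -/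

section Balance

variable (g₀ g₁ : Polynomial ℂ)

/-- The edge slope produced by `exists_lowerLeft_edge₃` is rational: if two exponent vectors with
different `y₁`-degree lie on the edge then `s = (m₁ - m'₁)/(m₂ - m'₂)`. -/
theorem edgeSlope_eq_div {s : ℝ} {m mb : Fin 3 →₀ ℕ} (hne : m 2 ≠ mb 2)
    (hw : ((m 1 : ℝ) - s * m 2) = (mb 1 : ℝ) - s * mb 2) :
    s = (((m 1 : ℤ) - mb 1 : ℤ) : ℝ) / (((m 2 : ℤ) - mb 2 : ℤ) : ℝ) := by
  have h2 : ((m 2 : ℝ) - mb 2) ≠ 0 := by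
    intro h
    apply hne
    have : (m 2 : ℝ) = mb 2 := by linarith
    exact_mod_cast this
  push_cast
  field_simp
  linarith

variable {g₀ g₁}

/-- **The balance polynomial on a curved real line.**  `deg g₀ = deg g₁ = n`, `Im(lc₁/lc₀) = 0`,
`Re(lc₁/lc₀) + s ≠ 0`: then `R_s = g₁ + s g₀` has degree `n`, leading coefficient
`lc₁ + s lc₀ ≠ 0`, `(n-1)`-coefficient `(g₁)_{n-1} + s (g₀)_{n-1}`, and for every root direction
`ω` of `lc(R_s) X^n = 2πiσ` the leading real parts `Re(lc₀ ω^n)`, `Re(lc₁ ω^n)` VANISH. (new) -/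
theorem balance_curvedReal (hn : 1 ≤ g₀.natDegree) (heq : g₁.natDegree = g₀.natDegree)
    (him : (g₁.leadingCoeff / g₀.leadingCoeff).im = 0) (s : ℝ)
    (hs : (g₁.leadingCoeff / g₀.leadingCoeff).re + s ≠ 0) :
    (g₁ + Polynomial.C (s : ℂ) * g₀).natDegree = g₀.natDegree ∧
      (g₁ + Polynomial.C (s : ℂ) * g₀).leadingCoeff = g₁.leadingCoeff + (s : ℂ) * g₀.leadingCoeff ∧
      g₁.leadingCoeff + (s : ℂ) * g₀.leadingCoeff ≠ 0 ∧
      (g₁ + Polynomial.C (s : ℂ) * g₀).coeff (g₀.natDegree - 1) =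
        g₁.coeff (g₀.natDegree - 1) + (s : ℂ) * g₀.coeff (g₀.natDegree - 1) ∧
      ∀ (ω : ℂ) (σ : ℤ), (g₁.leadingCoeff + (s : ℂ) * g₀.leadingCoeff) * ω ^ g₀.natDegree =
          2 * Real.pi * I * σ → (g₀.leadingCoeff * ω ^ g₀.natDegree).re = 0 := by
  have hg₀0 : g₀ ≠ 0 := by rintro rfl; rw [Polynomial.natDegree_zero] at hn; omega
  have hlc₀ : g₀.leadingCoeff ≠ 0 := Polynomial.leadingCoeff_ne_zero.2 hg₀0
  set lam : ℝ := (g₁.leadingCoeff / g₀.leadingCoeff).re with hlam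
  have hratio : g₁.leadingCoeff / g₀.leadingCoeff = (lam : ℂ) := by
    apply Complex.ext
    · simp [hlam]
    · simp [him]
  have hlc₁ : g₁.leadingCoeff = (lam : ℂ) * g₀.leadingCoeff := by
    rw [← hratio]; field_simp
  have hsum : g₁.leadingCoeff + (s : ℂ) * g₀.leadingCoeff = ((lam + s : ℝ) : ℂ) * g₀.leadingCoeff := by
    rw [hlc₁]; push_cast; ring
  have hsum0 : g₁.leadingCoeff + (s : ℂ) * g₀.leadingCoeff ≠ 0 := by
    rw [hsum]
    exact mul_ne_zero (Complex.ofReal_ne_zero.2 hs) hlc₀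
  -- degree and coefficients of `R_s`
  have hdeg_le : (g₁ + Polynomial.C (s : ℂ) * g₀).natDegree ≤ g₀.natDegree :=
    (Polynomial.natDegree_add_le _ _).trans
      (max_le heq.le ((Polynomial.natDegree_C_mul_le _ _).trans le_rfl))
  have hcoeff : ∀ k, (g₁ + Polynomial.C (s : ℂ) * g₀).coeff k = g₁.coeff k + (s : ℂ) * g₀.coeff k := by
    intro k; rw [Polynomial.coeff_add, Polynomial.coeff_C_mul]
  have htop : (g₁ + Polynomial.C (s : ℂ) * g₀).coeff g₀.natDegree =
      g₁.leadingCoeff + (s : ℂ) * g₀.leadingCoeff := by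
    rw [hcoeff, Polynomial.leadingCoeff, Polynomial.leadingCoeff, heq]
  have hdeg : (g₁ + Polynomial.C (s : ℂ) * g₀).natDegree = g₀.natDegree :=
    le_antisymm hdeg_le (Polynomial.le_natDegree_of_ne_zero (by rw [htop]; exact hsum0))
  have hlcR : (g₁ + Polynomial.C (s : ℂ) * g₀).leadingCoeff =
      g₁.leadingCoeff + (s : ℂ) * g₀.leadingCoeff := by
    rw [Polynomial.leadingCoeff, hdeg, htop]
  refine ⟨hdeg, hlcR, hsum0, hcoeff _, fun ω σ hω => ?_⟩
  rw [hsum] at hω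
  have hls : ((lam + s : ℝ) : ℂ) ≠ 0 := Complex.ofReal_ne_zero.2 hs
  have e : g₀.leadingCoeff * ω ^ g₀.natDegree = (2 * Real.pi * I * σ) / ((lam + s : ℝ) : ℂ) := by
    rw [eq_div_iff hls, ← hω]; ring
  rw [e, Complex.div_ofReal_re]
  simp [Complex.mul_re]

end Balance

/-! ## Part B. Escaping exponential points over a curved real line -/

/-- **Escaping zeros of `Q(t; e^{g₀(t)}, e^{g₁(t)})` over a curved real line.**
`deg g₀ = deg g₁ = n ≥ 2`, `Im(lc₁/lc₀) = 0`, `Re(lc₁/lc₀)` irrational,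
`lc₀ (g₁)_{n-1} ≠ lc₁ (g₀)_{n-1}`; `Q` with two monomials of different `y₁`-degree.  Then there are
`t_k` with `Q(t_k; e^{g₀(t_k)}, e^{g₁(t_k)}) = 0` and `|Re g₀(t_k)|/log(2 + ‖g₀(t_k)‖) → ∞`. (new) -/
theorem exists_paramSurface_expPoints_of_curvedReal (g₀ g₁ : Polynomial ℂ)
    (hn : 2 ≤ g₀.natDegree) (heq : g₁.natDegree = g₀.natDegree)
    (him : (g₁.leadingCoeff / g₀.leadingCoeff).im = 0)
    (hirr : Irrational (g₁.leadingCoeff / g₀.leadingCoeff).re)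
    (hsub : g₀.leadingCoeff * g₁.coeff (g₀.natDegree - 1) ≠
      g₁.leadingCoeff * g₀.coeff (g₀.natDegree - 1))
    (P : MvPolynomial (Fin 3) ℂ) (h2 : ∃ m ∈ P.support, ∃ m' ∈ P.support, m 2 ≠ m' 2) :
    ∃ t : ℕ → ℂ, (∀ k, MvPolynomial.eval ![t k, exp (g₀.eval (t k)), exp (g₁.eval (t k))] P = 0) ∧
      Tendsto (fun k => |(g₀.eval (t k)).re| / Real.log (2 + ‖g₀.eval (t k)‖)) atTop atTop := by
  classical
  have hg₀ : 1 ≤ g₀.natDegree := by omega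
  have hg₀0 : g₀ ≠ 0 := by rintro rfl; rw [Polynomial.natDegree_zero] at hn; omega
  have hlc₀ : g₀.leadingCoeff ≠ 0 := Polynomial.leadingCoeff_ne_zero.2 hg₀0
  obtain ⟨s, mb, hmb, hE1, hE2, ms, hmsA, hms2, hmsw⟩ := exists_lowerLeft_edge₃ P.support h2
  -- `λ + s ≠ 0` since `s ∈ ℚ`
  have hs : (g₁.leadingCoeff / g₀.leadingCoeff).re + s ≠ 0 := by
    intro h0
    have hseq := edgeSlope_eq_div hms2 hmsw
    have hd0 : ((ms 2 : ℤ) - mb 2 : ℤ) ≠ 0 := by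
      have : (ms 2 : ℤ) ≠ mb 2 := by exact_mod_cast hms2
      omega
    apply hirr.ne_rational (-((ms 1 : ℤ) - mb 1)) ((ms 2 : ℤ) - mb 2)
    have : (g₁.leadingCoeff / g₀.leadingCoeff).re = -s := by linarith
    rw [this, hseq]
    push_cast
    ring
  obtain ⟨hdegR, hlcR, hsum0, hcoeffR, hre0R⟩ := balance_curvedReal hg₀ heq him s hs
  set R₀ : Polynomial ℂ := g₁ + Polynomial.C (s : ℂ) * g₀ with hR₀
  have hdR : 2 ≤ R₀.natDegree := by rw [hdegR]; exact hn
  have hReval : ∀ t : ℂ, R₀.eval t = g₁.eval t + (s : ℂ) * g₀.eval t := by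
    intro t; simp [hR₀, Polynomial.eval_add, Polynomial.eval_mul]
  -- the sub-leading coefficient of `g₀` relative to the roots of `R₀` is nonzero
  set τ : ℂ := -(R₀.coeff (R₀.natDegree - 1) / (R₀.natDegree * R₀.leadingCoeff)) with hτ_def
  set cc : ℂ := g₀.coeff (g₀.natDegree - 1) + g₀.natDegree * g₀.leadingCoeff * τ with hcc_def
  have hnC : (g₀.natDegree : ℂ) ≠ 0 := Nat.cast_ne_zero.2 (by omega)
  have hccmul : cc * (g₁.leadingCoeff + (s : ℂ) * g₀.leadingCoeff) =
      g₀.coeff (g₀.natDegree - 1) * g₁.leadingCoeff -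
        g₀.leadingCoeff * g₁.coeff (g₀.natDegree - 1) := by
    have hsum0' : g₁.leadingCoeff + g₀.leadingCoeff * (s : ℂ) ≠ 0 := by
      rw [mul_comm]; exact hsum0
    rw [hcc_def, hτ_def, hdegR, hlcR, hcoeffR]
    rw [show g₀.coeff (g₀.natDegree - 1) + (g₀.natDegree : ℂ) * g₀.leadingCoeff *
        -((g₁.coeff (g₀.natDegree - 1) + (s : ℂ) * g₀.coeff (g₀.natDegree - 1)) /
          ((g₀.natDegree : ℂ) * (g₁.leadingCoeff + (s : ℂ) * g₀.leadingCoeff))) =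
        g₀.coeff (g₀.natDegree - 1) - g₀.leadingCoeff *
          (g₁.coeff (g₀.natDegree - 1) + (s : ℂ) * g₀.coeff (g₀.natDegree - 1)) /
            (g₁.leadingCoeff + (s : ℂ) * g₀.leadingCoeff) by field_simp; ring]
    rw [sub_mul, div_mul_cancel₀ _ hsum0]
    ring
  have hcc0 : cc ≠ 0 := by
    intro h0
    apply hsub
    have h1 := hccmul
    rw [h0, zero_mul] at h1
    linear_combination h1
  -- a root direction with NEGATIVE sub-leading real part (`n ∤ n - 1`)
  obtain ⟨ω, σ, hσ, hω, hcre⟩ := exists_rootDirection_re_neg_of_not_dvd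
    (g₁.leadingCoeff + (s : ℂ) * g₀.leadingCoeff) cc hsum0 hcc0 hn
    (not_dvd_pred_of_dvd hn hg₀ dvd_rfl)
  have hωR : R₀.leadingCoeff * ω ^ R₀.natDegree = 2 * Real.pi * I * σ := by
    rw [hlcR, hdegR]; exact hω
  have hre0 : (g₀.leadingCoeff * ω ^ g₀.natDegree).re = 0 := hre0R ω σ hω
  have hc : ((g₀.coeff (g₀.natDegree - 1) + g₀.natDegree * g₀.leadingCoeff *
      (-(R₀.coeff (R₀.natDegree - 1) / (R₀.natDegree * R₀.leadingCoeff)))) *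
        ω ^ (g₀.natDegree - 1)).re < 0 := by
    rw [← hτ_def, ← hcc_def]; exact hcre
  -- the coefficient data of the edge (as in gen 19's `exists_paramSurface_expPoints`)
  set M := P.support.filter
    (fun m : Fin 3 →₀ ℕ => ((m 1 : ℝ) - s * m 2) = (mb 1 : ℝ) - s * mb 2) with hM
  set Nf := P.support.filter
    (fun m : Fin 3 →₀ ℕ => ¬ ((m 1 : ℝ) - s * m 2) = (mb 1 : ℝ) - s * mb 2) with hNf
  have hmbM : mb ∈ M := Finset.mem_filter.2 ⟨hmb, rfl⟩
  have hmsM : ms ∈ M := Finset.mem_filter.2 ⟨hmsA, hmsw⟩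
  have hMle : ∀ m ∈ M, mb 2 ≤ m 2 := fun m hm =>
    hE2 m (Finset.mem_filter.1 hm).1 (Finset.mem_filter.1 hm).2
  set q : (Fin 3 →₀ ℕ) → Polynomial ℂ := fun m =>
    Polynomial.C (P.coeff m) * Polynomial.X ^ (m 0) with hq_def
  set e : (Fin 3 →₀ ℕ) → ℕ := fun m => m 2 - mb 2 with he_def
  have hq_deg : ∀ m ∈ M, (q m).natDegree = m 0 := fun m hm =>
    Polynomial.natDegree_C_mul_X_pow _ _
      (MvPolynomial.mem_support_iff.1 (Finset.mem_filter.1 hm).1)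
  have hq_lc : ∀ m, (q m).leadingCoeff = P.coeff m := fun m =>
    Polynomial.leadingCoeff_C_mul_X_pow _ _
  obtain ⟨μ, κ, hκ, ma, hma, mc, hmc, hjne, hja, hjc⟩ := exists_upper_edge M e (fun m => m 0)
    ⟨mb, hmbM, ms, hmsM, by
      have hlt : mb 2 < ms 2 := lt_of_le_of_ne (hMle ms hmsM) (Ne.symm hms2)
      simp only [he_def]; omega⟩
  have hκ' : ∀ m ∈ M, ((q m).natDegree : ℝ) + μ * e m ≤ κ := fun m hm => by
    rw [hq_deg m hm]; exact hκ m hm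
  set Jt := M.filter (fun m => ((q m).natDegree : ℝ) + μ * e m = κ) with hJt
  set Qμ : Polynomial ℂ := ∑ m ∈ Jt, Polynomial.C (q m).leadingCoeff * Polynomial.X ^ (e m)
    with hQμ
  have hmem_top : ∀ {m}, m ∈ M → ((m 0 : ℝ) + μ * e m = κ) → m ∈ Jt := fun {m} hm h =>
    Finset.mem_filter.2 ⟨hm, by rw [hq_deg m hm]; exact h⟩
  have hmaT : ma ∈ Jt := hmem_top hma hja
  have hmcT : mc ∈ Jt := hmem_top hmc hjc
  have hinj : ∀ m ∈ Jt, ∀ m' ∈ Jt, e m = e m' → m = m' := by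
    intro m hm m' hm' hee
    obtain ⟨hmM, hmt⟩ := Finset.mem_filter.1 hm
    obtain ⟨hm'M, hm't⟩ := Finset.mem_filter.1 hm'
    have h2eq : m 2 = m' 2 := by
      have := hMle m hmM; have := hMle m' hm'M
      simp only [he_def] at hee; omega
    have h0eq : m 0 = m' 0 := by
      rw [hq_deg m hmM] at hmt; rw [hq_deg m' hm'M] at hm't
      rw [hee] at hmt
      have : (m 0 : ℝ) = m' 0 := by linarith
      exact_mod_cast this
    exact gse_eq_of_weight_eq ((Finset.mem_filter.1 hmM).2.trans (Finset.mem_filter.1 hm'M).2.symm)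
      h2eq h0eq
  have hcoeff : ∀ m₁ ∈ Jt, Qμ.coeff (e m₁) = P.coeff m₁ := by
    intro m₁ hm₁
    rw [hQμ, Polynomial.finsetSum_coeff, Finset.sum_eq_single m₁]
    · rw [Polynomial.coeff_C_mul, Polynomial.coeff_X_pow, if_pos rfl, mul_one, hq_lc]
    · intro m hm hne
      rw [Polynomial.coeff_C_mul, Polynomial.coeff_X_pow, if_neg, mul_zero]
      exact fun h => hne (hinj m hm m₁ hm₁ h.symm)
    · intro h; exact (h hm₁).elim
  have hca : Qμ.coeff (e ma) ≠ 0 := by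
    rw [hcoeff ma hmaT]; exact MvPolynomial.mem_support_iff.1 (Finset.mem_filter.1 hma).1
  have hccf : Qμ.coeff (e mc) ≠ 0 := by
    rw [hcoeff mc hmcT]; exact MvPolynomial.mem_support_iff.1 (Finset.mem_filter.1 hmc).1
  obtain ⟨θ, hθ0, hθ⟩ : ∃ θ : ℂ, θ ≠ 0 ∧ Qμ.eval θ = 0 := by
    rcases lt_or_gt_of_ne hjne with hlt | hgt
    · exact exists_root_ne_zero_of_coeff_ne_zero (e mc) Qμ (e ma) hlt hca hccf
    · exact exists_root_ne_zero_of_coeff_ne_zero (e ma) Qμ (e mc) hgt hccf hca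
  have hQ : Qμ ≠ 0 := fun h => hca (by rw [h, Polynomial.coeff_zero])
  -- the weight gap and degree bounds (verbatim from gen 19)
  obtain ⟨δ, hδpos, hδ⟩ : ∃ δ : ℝ, 0 < δ ∧ ∀ m ∈ P.support,
      ¬ ((m 1 : ℝ) - s * m 2) = (mb 1 : ℝ) - s * mb 2 →
        δ ≤ ((m 1 : ℝ) - s * m 2) - ((mb 1 : ℝ) - s * mb 2) := by
    by_cases hNe : Nf.Nonempty
    · obtain ⟨mm, hmm, hmmmin⟩ := Nf.exists_min_image
        (fun m => ((m 1 : ℝ) - s * m 2) - ((mb 1 : ℝ) - s * mb 2)) hNe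
      obtain ⟨hmmA, hmmw⟩ := Finset.mem_filter.1 hmm
      refine ⟨((mm 1 : ℝ) - s * mm 2) - ((mb 1 : ℝ) - s * mb 2), ?_, fun m hm hmw =>
        hmmmin m (Finset.mem_filter.2 ⟨hm, hmw⟩)⟩
      have := hE1 mm hmmA
      rcases this.lt_or_eq with h | h
      · linarith
      · exact absurd h.symm hmmw
    · refine ⟨1, zero_lt_one, fun m hm hmw => ?_⟩
      exact absurd ⟨m, Finset.mem_filter.2 ⟨hm, hmw⟩⟩ hNe
  set N : ℕ := P.support.sup (fun m => m 0) with hNdef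
  have hN : ∀ m ∈ P.support, m 0 ≤ N := fun m hm => Finset.le_sup (f := fun m => m 0) hm
  set N₂ : ℕ := P.support.sup (fun m => m 2) with hN₂def
  have hN₂ : ∀ m ∈ P.support, m 2 ≤ N₂ := fun m hm => Finset.le_sup (f := fun m => m 2) hm
  set N' : ℕ := ⌈(N₂ : ℝ) * |μ|⌉₊ with hN'def
  have hN' : ∀ m ∈ P.support, |(m 2 : ℝ) - mb 2| * |μ| ≤ N' := by
    intro m hm
    have h1 : |(m 2 : ℝ) - mb 2| ≤ N₂ := by
      rw [abs_le]
      constructor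
      · have : (mb 2 : ℝ) ≤ N₂ := by exact_mod_cast hN₂ mb hmb
        linarith [(Nat.cast_nonneg (m 2) : (0 : ℝ) ≤ m 2)]
      · have : (m 2 : ℝ) ≤ N₂ := by exact_mod_cast hN₂ m hm
        linarith [(Nat.cast_nonneg (mb 2) : (0 : ℝ) ≤ mb 2)]
    exact (mul_le_mul_of_nonneg_right h1 (abs_nonneg μ)).trans (Nat.le_ceil _)
  set E : ℂ → ℂ := fun t => ∑ m ∈ Nf, P.coeff m * t ^ (m 0) *
    exp ((((m 1 : ℝ) - s * m 2 - ((mb 1 : ℝ) - s * mb 2) : ℝ) : ℂ) * g₀.eval t +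
      (((m 2 : ℝ) - mb 2 : ℝ) : ℂ) * R₀.eval t) with hEdef
  have hEdiff : Differentiable ℂ E := by
    refine Differentiable.fun_sum fun m _ => ?_
    refine ((differentiable_const _).mul (differentiable_id.pow _)).mul ?_
    refine (((differentiable_const _).mul (Polynomial.differentiable _)).add
      ((differentiable_const _).mul (Polynomial.differentiable _))).cexp
  have hEb : ∀ B : ℝ, ∃ C : ℝ, 0 ≤ C ∧ ∃ N'' : ℕ, ∀ t : ℂ, (g₀.eval t).re ≤ 0 → 1 ≤ ‖t‖ →
      |(R₀.eval t).re - μ * Real.log ‖t‖| ≤ B →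
        ‖E t‖ ≤ C * (1 + ‖t‖) ^ N'' * Real.exp (δ * (g₀.eval t).re) := by
    intro B
    refine ⟨∑ m ∈ Nf, ‖P.coeff m‖ * Real.exp (|(m 2 : ℝ) - mb 2| * B),
      Finset.sum_nonneg fun m _ => by positivity, N + N', fun t ht ht1 htB => ?_⟩
    have htB' : |(g₁.eval t + (s : ℂ) * g₀.eval t).re - μ * Real.log ‖t‖| ≤ B := by
      rwa [hReval] at htB
    have h := norm_offEdgeSum₃_le_log₂ (P := P) hδ hN hN' (t := t) ht ht1 htB'
    simp only [hEdef, hReval]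
    exact h
  -- the root package with sub-leading decay, and the engine of file XXXIII
  set c₀ : ℂ := Complex.log θ with hc₀_def
  have hc₀ : exp c₀ = θ := Complex.exp_log hθ0
  obtain ⟨z₀, Lg, Λ, Λ', K₀, hΛ, hΛ'0, hdecay, hpos, hroot⟩ :=
    exists_ray_roots_log_sub R₀ g₀ hdR hn ω σ hσ hωR hre0 hc μ c₀
  obtain ⟨t, K₁, ht, hdist⟩ := exists_escape_zeros_log_of_roots R₀ g₀ hdR M q e μ κ hκ' hθ0 hθ hQ
    z₀ Lg Λ Λ' hΛ hΛ'0 hdecay (fun j => (hroot j).1)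
    (fun j => by rw [(hroot j).2.1, hc₀]) (fun j => (hroot j).2.2.1) (fun j => (hroot j).2.2.2.1)
    (fun j => (hroot j).2.2.2.2.1) (fun j => (hroot j).2.2.2.2.2.1)
    (fun j => (hroot j).2.2.2.2.2.2.1) (fun j => (hroot j).2.2.2.2.2.2.2) E hEdiff hδpos hEb
  refine ⟨t, fun k => ?_, ?_⟩
  · rw [eval₃_exp_exp_eq_mul_edgeSum hE2 (t k) (g₀.eval (t k)) (g₁.eval (t k))]
    have h := ht k
    rw [hEdef] at h
    simp only [hReval] at h
    rw [h, mul_zero]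
  · -- growth at the sub-leading order: the zeros are located to `o(1)`
    have hz₀norm : Tendsto (fun j => ‖z₀ j‖) atTop atTop :=
      tendsto_atTop_mono (fun j => (hroot j).2.2.2.2.1)
        (hΛ.atTop_div_const (by norm_num : (0 : ℝ) < 3))
    have hapos : 0 < ‖R₀.leadingCoeff‖ := norm_pos_iff.2 (by rw [hlcR]; exact hsum0)
    have hd1 : 1 ≤ R₀.natDegree - 1 := by omega
    have h1 : Tendsto (fun k => t k - z₀ (k + K₁)) atTop (𝓝 0) := by
      have hb : Tendsto (fun k => 2 / (‖R₀.leadingCoeff‖ * ‖z₀ (k + K₁)‖)) atTop (𝓝 0) :=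
        tendsto_const_nhds.div_atTop
          ((hz₀norm.comp (tendsto_add_atTop_nat K₁)).const_mul_atTop hapos)
      refine tendsto_zero_iff_norm_tendsto_zero.2
        (squeeze_zero (fun k => norm_nonneg _) (fun k => (hdist k).trans ?_) hb)
      have hz1 : 1 ≤ ‖z₀ (k + K₁)‖ := (hroot (k + K₁)).2.2.1
      refine div_le_div_of_nonneg_left (by norm_num) (by positivity) ?_
      refine mul_le_mul_of_nonneg_left ?_ hapos.le
      calc ‖z₀ (k + K₁)‖ = ‖z₀ (k + K₁)‖ ^ 1 := (pow_one _).symm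
        _ ≤ ‖z₀ (k + K₁)‖ ^ (R₀.natDegree - 1) := pow_le_pow_right₀ hz1 hd1
    have h2 := hpos.comp (tendsto_add_atTop_nat K₁)
    have h3 := h1.add h2
    rw [zero_add] at h3
    have hρ : Tendsto (fun k => (((k + K₁ + K₀ : ℕ) : ℝ)) + 1) atTop atTop :=
      (tendsto_natCast_add_atTop 1).comp
        ((tendsto_add_atTop_nat K₀).comp (tendsto_add_atTop_nat K₁))
    refine tendsto_growth_eval_of_subleading g₀ hn ω _ hre0 hc.ne hρ ?_
    refine h3.congr fun k => ?_
    simp only [Function.comp_apply]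
    push_cast
    ring

/-! ## Part C. Density over a curved real line -/

section Main

variable (g₀ g₁ : Polynomial ℂ) {Q : MvPolynomial (Fin 3) ℂ}

/-- **MAIN THEOREM (non-split surfaces over a curved real line).**  `deg g₀ = deg g₁ = n ≥ 2`,
`Im(lc(g₁)/lc(g₀)) = 0`, `Re(lc(g₁)/lc(g₀))` irrational, `lc(g₀)(g₁)_{n-1} ≠ lc(g₁)(g₀)_{n-1}`;
`Q ∈ ℂ[t, y₀, y₁]` irreducible with two monomials of different `y₁`-degree ⟹ the exponential
points of `S(g; Q)` are Zariski dense.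
[cite: MantovaMasser2023, §1 Further remarks, p. 5 (the question, open in general)] (new) -/
theorem unprojectedDense_paramSurface₃_of_curvedReal (hn : 2 ≤ g₀.natDegree)
    (heq : g₁.natDegree = g₀.natDegree) (him : (g₁.leadingCoeff / g₀.leadingCoeff).im = 0)
    (hirrat : Irrational (g₁.leadingCoeff / g₀.leadingCoeff).re)
    (hsub : g₀.leadingCoeff * g₁.coeff (g₀.natDegree - 1) ≠
      g₁.leadingCoeff * g₀.coeff (g₀.natDegree - 1))
    (hirr : Irreducible Q) (h2 : ∃ m ∈ Q.support, ∃ m' ∈ Q.support, m 2 ≠ m' 2) :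
    UnprojectedDense {w : Fin 2 ⊕ Fin 2 → ℂ | ∃ t : ℂ, w (Sum.inl 0) = g₀.eval t ∧
      w (Sum.inl 1) = g₁.eval t ∧
      MvPolynomial.eval (Fin.cases t (fun i => w (Sum.inr i)) : Fin 3 → ℂ) Q = 0} := by
  have hg₀ : 1 ≤ g₀.natDegree := by omega
  obtain ⟨t, ht, hgr⟩ := exists_paramSurface_expPoints_of_curvedReal g₀ g₁ hn heq him hirrat
    hsub Q h2
  exact unprojectedDense_paramSurface₃_of_expPoints g₀ g₁ Q ht hgr
    (isIrreducibleClosed_paramSurface₃ g₀ g₁ hg₀ hirr)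
    (by rw [zariskiDim_paramSurface₃ g₀ g₁ hg₀ hirr])

end Main

end Summit.Schanuel.Schanuel.Theorems
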